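import Literature.AlgebraicGeometry.HodgeTheory.MonomialSupportedHypersurfaceNoInvariantsTorus
import Literature.AlgebraicGeometry.HodgeTheory.UniversalHypersurfaceDiscriminantExists
import Literature.AlgebraicGeometry.HodgeTheory.QbarFamilyLocalSystem
import Literature.AlgebraicGeometry.Motives.UniversalHypersurfaceQuasiProjective
import HarnessLib

/-!
# Middle-degree monodromy invariants of the universal family of smooth hypersurfaces, without the global invariant cycle
# theorem: zero in odd dimension, ambient classes in even dimension

Family `hodge`, layer `Literature/AlgebraicGeometry/HodgeTheory`; theorems only (no definition, no named fact). Written by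
the prover seat `hodge-nonav-19716-p2` (g6), cell `hodge-nonav`; companion of `MonomialSupportedHypersurfaceNoInvariantsTorus`
(the same statements for the monomial-supported families `π_M`) for the UNIVERSAL family
`π : 𝒴_U → U = {nonsingular forms of degree d in x₀, …, x_{n+1}}` (`UniversalHypersurface.family ℂ n d`) itself.

Classically (Deligne, Hodge II 4.1.1; Voisin II Thm. 4.24 / Cor. 4.25) the monodromy invariants of `Hᵏ(Y_s; ℚ)` are the
image of `Hᵏ(ℙⁿ⁺¹)`. In the MIDDLE degree `k = n` this follows without any Hodge theory from the torus trick
(`DiagonalTorus.diagonalAut_conj_mem_ratMonodromyGroup`: every diagonal symmetry of the Fermat hypersurface is a monodromy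
transformation) and Shioda's character decomposition at the Fermat point (`V(0) = ⊥` in odd degree,
`V(0) ⊆ ι^* Hⁿ(ℙⁿ⁺¹)` in even degree), transported along a path of the path-connected base `U(ℂ)`
(`pathConnectedSpace_complexPoints_base`):

* `family_isRationalClass_transportFun` — transports of `Rⁿ π_* ℂ` preserve rational classes (Ehresmann over the smooth
  quasi-projective base; the tree's `isRationalClass_transportFun_of_isSmoothProjectiveFamily`);
* `family_ratInvariant_eq_zero_of_fermat` — `n = 2p + 1` odd, `d ≥ 2`: every `Γ_s`-invariant class of `Hⁿ(Y_s; ℚ)` is `0`;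
* `family_ofRatClass_ratInvariant_mem_range_of_fermat_even` — `n = 2r ≥ 2` even, `d ≥ 2`: the complexification of every
  `Γ_s`-invariant class of `Hⁿ(Y_s; ℚ)` is the restriction of a class of `Hⁿ(ℙⁿ⁺¹(ℂ); ℂ)` along `Y_s → 𝒴_U → ℙⁿ⁺¹`.

## References

* [Shioda1979HodgeFermat] T. Shioda, The Hodge conjecture for Fermat varieties, Math. Ann. 245 (1979), §1.
* [Katz2009] N. M. Katz, Another look at the Dwork family, Progr. Math. 269 (2009), §3.
* [VoisinHodgeII2003] C. Voisin, Hodge Theory and Complex Algebraic Geometry II, CUP 2003, §3.1.2, Thm. 4.24, Cor. 4.25,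
  §6.2.1.
* [CarlsonMullerStachPeters2017] J. Carlson, S. Müller-Stach, C. Peters, Period Mappings and Period Domains (2017),
  Lemma–Definition 15.3.7.
-/

noncomputable section

open CategoryTheory AlgebraicGeometry MvPolynomial
open Literature.AlgebraicTopology.SingularHomology
open Literature.AlgebraicGeometry.Motives
open Literature.AlgebraicGeometry.Motives.UniversalHypersurface

namespace Literature.AlgebraicGeometry.HodgeTheory.UniversalHypersurface

/-- **Transports of `Rᵏ π_* ℂ` of the universal family preserve rational classes** (`n, d ≥ 1`; Ehresmann over the smooth
quasi-projective base `U`). [cite: VoisinHodgeII2003, §3.1.2] -/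
theorem family_isRationalClass_transportFun {n d : ℕ} (hn : 1 ≤ n) (hd : 1 ≤ d) (k : ℕ)
    (hU : IsCohomologicallyLocallyTrivialOn (family ℂ n d) Set.univ)
    {s t : (Set.univ : Set (ComplexPoints (base ℂ n d)))} (γ : Path.Homotopic.Quotient s t)
    {α : complexBetti (fiberOver (family ℂ n d) s.1) k} (hα : IsRationalClass α) :
    IsRationalClass (transportFun (family ℂ n d) k hU γ α) :=
  haveI := smoothOfRelativeDimension_base_hom ℂ n d
  isRationalClass_transportFun_of_isSmoothProjectiveFamily (family ℂ n d) k (0 + Fintype.card (DegIndex n d))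
    (isSmoothProjectiveFamily_family ℂ hn hd) (isQuasiProjectiveOver_base ℂ n d) γ hα

/-- **An embedding-compatible identification of the universal fibre over `[F]` with `X_F`** (`d ≥ 1`).
[cite: VoisinHodgeII2003, §6.2.1] -/
theorem exists_compatible_iso_pointOfForm {n d : ℕ} (hd : 1 ≤ d) {F : MvPolynomial (Fin (n + 2)) ℂ}
    (hF : F.IsHomogeneous d) (hJ : SmoothHypersurface.IsNonsingularForm ℂ F) :
    ∃ e : fiberOver (family ℂ n d) (pointOfForm ℂ n d hF hJ) ≅ SmoothHypersurface.hypersurface F,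
      e.hom ≫ SmoothHypersurface.hypersurfaceι F =
        fiberι (family ℂ n d) (pointOfForm ℂ n d hF hJ) ≫ UniversalHypersurface.toProjectiveSpace ℂ n d := by
  obtain ⟨e₀, he₀⟩ := exists_fiberIso_comp_hypersurfaceι ℂ n d (by omega) (pointOfForm ℂ n d hF hJ)
  have hG : pointForm ℂ n d (pointOfForm ℂ n d hF hJ) = F := pointForm_pointOfForm ℂ n d hF hJ
  revert e₀ he₀
  generalize pointForm ℂ n d (pointOfForm ℂ n d hF hJ) = G at hG
  subst hG
  intro e₀ he₀
  exact ⟨e₀, he₀⟩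

/-- **Odd-dimensional middle-degree monodromy invariants of the universal family vanish, unconditionally**: for
`n = 2p + 1`, `d ≥ 2`, every class of `Hⁿ(Y_s; ℚ)` fixed by the rational monodromy group `Γ_s` of the universal family of
smooth degree-`d` hypersurfaces in `ℙⁿ⁺¹` is zero (transport to the Fermat point, torus trick, `V(0) = ⊥`).
[cite: Shioda1979HodgeFermat, §1 (1.3)–(1.4)] [cite: Katz2009, §3] [cite: VoisinHodgeII2003, §3.1.2] -/
theorem family_ratInvariant_eq_zero_of_fermat {p d : ℕ} (hd : 2 ≤ d)
    (hU : IsCohomologicallyLocallyTrivialOn (family ℂ (2 * p + 1) d) Set.univ)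
    (s : ComplexPoints (base ℂ (2 * p + 1) d))
    (x : bettiCohomology (fiberOver (family ℂ (2 * p + 1) d) s) (2 * p + 1))
    (hx : ∀ g ∈ ratMonodromyGroup (family ℂ (2 * p + 1) d) (2 * p + 1) hU ⟨s, Set.mem_univ s⟩, g x = x) :
    x = 0 := by
  have hn : 1 ≤ 2 * p + 1 := by omega
  have hd1 : 1 ≤ d := by omega
  haveI : NeZero d := ⟨by omega⟩
  have hF : (fermatPolynomial ℂ (2 * p + 1) d).IsHomogeneous d := isHomogeneous_fermatPolynomial _ d
  have hJ : SmoothHypersurface.IsNonsingularForm ℂ (fermatPolynomial ℂ (2 * p + 1) d) :=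
    isNonsingularForm_fermatPolynomial hd1
  -- transport to the Fermat point
  haveI := pathConnectedSpace_complexPoints_base (n := 2 * p + 1) hd
  obtain ⟨T, hT⟩ := exists_ratTransport (family ℂ (2 * p + 1) d) (2 * p + 1) hU
    (fun _ _ γ _ hα => family_isRationalClass_transportFun hn hd1 _ hU γ hα)
    (s := ⟨s, Set.mem_univ s⟩) (t := ⟨pointOfForm ℂ (2 * p + 1) d hF hJ, Set.mem_univ _⟩)
    ⟦(PathConnectedSpace.somePath s (pointOfForm ℂ (2 * p + 1) d hF hJ)).map
      (continuous_id.subtype_mk fun y => Set.mem_univ y)⟧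
  have hy := forall_apply_eq_of_isRatTransport (family ℂ (2 * p + 1) d) (2 * p + 1) hU hT x hx
  -- the torus trick
  obtain ⟨e, he⟩ := exists_compatible_iso_pointOfForm hd1 hF hJ
  have hz : ∀ a : fermatGroup (2 * p + 1) d,
      BettiUniverse.pull (diagonalAut _ (fermatGroup_le_diagonalStabilizer d a.2)) (2 * p + 1)
        (BettiUniverse.pullEquiv e (2 * p + 1) (T x)) = BettiUniverse.pullEquiv e (2 * p + 1) (T x) := by
    intro a
    have hmem := DiagonalTorus.diagonalAut_conj_mem_ratMonodromyGroup hF hJ hn hd1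
      (fermatGroup_le_diagonalStabilizer d a.2) (2 * p + 1) e he
    have h := hy _ hmem
    rw [LinearEquiv.trans_apply, LinearEquiv.trans_apply, LinearEquiv.symm_apply_eq] at h
    exact h
  -- complexify
  have hnat : ∀ {X Y : SchemeOver ℂ} (g : X ⟶ Y) (w : bettiCohomology Y (2 * p + 1)),
      ofRatClass _ (2 * p + 1) (BettiUniverse.pull g (2 * p + 1) w) =
        complexBetti.map g (2 * p + 1) (ofRatClass _ (2 * p + 1) w) := fun g w =>
    ofRatClass_map (2 * p + 1) (AlgPoints.mapContinuous (L := ℂ) g) w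
  have hc : ofRatClass _ (2 * p + 1) (BettiUniverse.pullEquiv e (2 * p + 1) (T x)) ∈
      fermatEigenspace d (0 : Fin (2 * p + 1 + 2) → ZMod d) (2 * p + 1) := by
    rw [mem_fermatEigenspace_iff]
    intro a
    have h1 : ((fermatCharacter d (0 : Fin (2 * p + 1 + 2) → ZMod d) a : ℂˣ) : ℂ) = 1 := by
      rw [fermatCharacter_apply]
      simp only [Pi.zero_apply, ZMod.val_zero, pow_zero, Finset.prod_const_one, Units.val_one]
    rw [h1, one_smul]
    have h := congrArg (ofRatClass _ (2 * p + 1)) (hz a)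
    rw [hnat] at h
    exact h
  rw [fermatEigenspace_eq_bot_odd_of_apply_eq_zero hd1 p (β := (0 : Fin (2 * p + 1 + 2) → ZMod d))
    (i := 0) rfl, Submodule.mem_bot] at hc
  have hz0 : BettiUniverse.pullEquiv e (2 * p + 1) (T x) = 0 :=
    ofRatClass_injective (2 * p + 1) (by rw [hc, map_zero])
  have hTx : T x = 0 := (BettiUniverse.pullEquiv e (2 * p + 1)).injective (by rw [hz0, map_zero])
  exact T.injective (by rw [hTx, map_zero])

/-- **Even-dimensional middle-degree monodromy invariants of the universal family are ambient classes, unconditionally**: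
for `n = 2r ≥ 2`, `d ≥ 2`, the complexification of every class of `Hⁿ(Y_s; ℚ)` fixed by the rational monodromy group `Γ_s`
is the restriction of a class of `Hⁿ(ℙⁿ⁺¹(ℂ); ℂ)` along `Y_s → 𝒴_U → ℙⁿ⁺¹` (so the invariants are spanned by `hʳ|_{Y_s}`).
[cite: Shioda1979HodgeFermat, §1 (1.3)–(1.4)] [cite: Katz2009, §3] [cite: VoisinHodgeII2003, §3.1.2 and Thm. 4.24] -/
theorem family_ofRatClass_ratInvariant_mem_range_of_fermat_even {r d : ℕ} (hr : 1 ≤ r) (hd : 2 ≤ d)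
    (hU : IsCohomologicallyLocallyTrivialOn (family ℂ (2 * r) d) Set.univ)
    (s : ComplexPoints (base ℂ (2 * r) d))
    (x : bettiCohomology (fiberOver (family ℂ (2 * r) d) s) (2 * r))
    (hx : ∀ g ∈ ratMonodromyGroup (family ℂ (2 * r) d) (2 * r) hU ⟨s, Set.mem_univ s⟩, g x = x) :
    ∃ η : complexBetti (projectiveSpace (2 * r + 1) ℂ) (2 * r),
      ofRatClass _ (2 * r) x =
        complexBetti.map (fiberι (family ℂ (2 * r) d) s ≫ UniversalHypersurface.toProjectiveSpace ℂ (2 * r) d) (2 * r) η := by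
  have hn : 1 ≤ 2 * r := by omega
  have hd1 : 1 ≤ d := by omega
  haveI : NeZero d := ⟨by omega⟩
  have hF : (fermatPolynomial ℂ (2 * r) d).IsHomogeneous d := isHomogeneous_fermatPolynomial _ d
  have hJ : SmoothHypersurface.IsNonsingularForm ℂ (fermatPolynomial ℂ (2 * r) d) :=
    isNonsingularForm_fermatPolynomial hd1
  -- transport to the Fermat point
  haveI := pathConnectedSpace_complexPoints_base (n := 2 * r) hd
  set δ : Path.Homotopic.Quotient (⟨s, Set.mem_univ s⟩ : (Set.univ : Set (ComplexPoints (base ℂ (2 * r) d))))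
      ⟨pointOfForm ℂ (2 * r) d hF hJ, Set.mem_univ _⟩ :=
    ⟦(PathConnectedSpace.somePath s (pointOfForm ℂ (2 * r) d hF hJ)).map
      (continuous_id.subtype_mk fun y => Set.mem_univ y)⟧ with hδ
  obtain ⟨T, hT⟩ := exists_ratTransport (family ℂ (2 * r) d) (2 * r) hU
    (fun _ _ γ _ hα => family_isRationalClass_transportFun hn hd1 _ hU γ hα) δ
  have hy := forall_apply_eq_of_isRatTransport (family ℂ (2 * r) d) (2 * r) hU hT x hx
  -- the torus trick
  obtain ⟨e, he⟩ := exists_compatible_iso_pointOfForm hd1 hF hJ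
  have hz : ∀ a : fermatGroup (2 * r) d,
      BettiUniverse.pull (diagonalAut _ (fermatGroup_le_diagonalStabilizer d a.2)) (2 * r)
        (BettiUniverse.pullEquiv e (2 * r) (T x)) = BettiUniverse.pullEquiv e (2 * r) (T x) := by
    intro a
    have hmem := DiagonalTorus.diagonalAut_conj_mem_ratMonodromyGroup hF hJ hn hd1
      (fermatGroup_le_diagonalStabilizer d a.2) (2 * r) e he
    have h := hy _ hmem
    rw [LinearEquiv.trans_apply, LinearEquiv.trans_apply, LinearEquiv.symm_apply_eq] at h
    exact h
  -- complexify: the class lies in `V(0) ⊆ ι^* H²ʳ(ℙ²ʳ⁺¹)`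
  have hnat : ∀ {X Y : SchemeOver ℂ} (g : X ⟶ Y) (w : bettiCohomology Y (2 * r)),
      ofRatClass _ (2 * r) (BettiUniverse.pull g (2 * r) w) =
        complexBetti.map g (2 * r) (ofRatClass _ (2 * r) w) := fun g w =>
    ofRatClass_map (2 * r) (AlgPoints.mapContinuous (L := ℂ) g) w
  have hc : ofRatClass _ (2 * r) (BettiUniverse.pullEquiv e (2 * r) (T x)) ∈
      fermatEigenspace d (0 : Fin (2 * r + 2) → ZMod d) (2 * r) := by
    rw [mem_fermatEigenspace_iff]
    intro a
    have h1 : ((fermatCharacter d (0 : Fin (2 * r + 2) → ZMod d) a : ℂˣ) : ℂ) = 1 := by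
      rw [fermatCharacter_apply]
      simp only [Pi.zero_apply, ZMod.val_zero, pow_zero, Finset.prod_const_one, Units.val_one]
    rw [h1, one_smul]
    have h := congrArg (ofRatClass _ (2 * r)) (hz a)
    rw [hnat] at h
    exact h
  obtain ⟨η, hη⟩ := fermatEigenspace_zero_le_range_map_hypersurfaceι hd1 hr hc
  refine ⟨η, ?_⟩
  -- read the class at the Fermat point through `e`, then transport back along `δ`
  have h0 : ofRatClass _ (2 * r) (T x) =
      complexBetti.map (fiberι (family ℂ (2 * r) d) (pointOfForm ℂ (2 * r) d hF hJ) ≫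
        UniversalHypersurface.toProjectiveSpace ℂ (2 * r) d) (2 * r) η := by
    have h1 : ofRatClass _ (2 * r) (T x) = complexBetti.map e.hom (2 * r)
        (ofRatClass _ (2 * r) (BettiUniverse.pullEquiv e (2 * r) (T x))) := by
      rw [BettiUniverse.pullEquiv_apply, hnat, e.complexBetti_map_hom_map_inv]
    rw [h1, ← hη, ← he, complexBetti.map_comp, ModuleCat.comp_apply]
  have h2 : transportFun (family ℂ (2 * r) d) (2 * r) hU δ (ofRatClass _ (2 * r) x) =
      complexBetti.map (fiberι (family ℂ (2 * r) d) (pointOfForm ℂ (2 * r) d hF hJ)) (2 * r)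
        (complexBetti.map (UniversalHypersurface.toProjectiveSpace ℂ (2 * r) d) (2 * r) η) := by
    rw [← hT x, h0, complexBetti.map_comp, ModuleCat.comp_apply]
  have h3 := transportFun_symm_transportFun (family ℂ (2 * r) d) (2 * r) hU δ (ofRatClass _ (2 * r) x)
  rw [h2, transportFun_map_fiberι] at h3
  rw [← h3, complexBetti.map_comp, ModuleCat.comp_apply]

end Literature.AlgebraicGeometry.HodgeTheory.UniversalHypersurface

end
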